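import Summits.KontsevichZagierPeriods.KontsevichZagierPeriods.Theses.HurwitzMicroSectors
import Summits.KontsevichZagierPeriods.KontsevichZagierPeriods.Theorems.HurwitzMicroSectorsNormalFormPrinciplePiBoxTransfer
import Summits.KontsevichZagierPeriods.KontsevichZagierPeriods.Theorems.HurwitzMicroSectorsNormalFormPrincipleVariants2238
import Summits.KontsevichZagierPeriods.KontsevichZagierPeriods.Theorems.HurwitzMicroSectorsNormalFormPrincipleVariants2233

/-! TTRL-lite variant V2326 of stmt-KontsevichZagierPeriods-3869

Variant V2326 = `stub_boxRigidity` (the leaf `BoxRigidity` of `NormalFormPrinciple`: two representations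
on open unit boxes with integrands of KZ's rational shape `p/q`, `p, q` over `ℚ`, and equal values are
KZ-equivalent) under the TWO-sided small-case move `fix_nat:m=8; bound_nat:m'≤4` (left dimension
frozen to `8`, right dimension `≤ 4`). Verdict of the attempt seat: **open** — this file is the
exact-strength certificate, not a proof of the variant. As for every two-sided sibling
(`…Variants2204/2233/2238`), the strength of a joint bound is that of its LARGEST dimension, here `8`:
* `stub_boxRigidity_var2326_iff_boxVanishing_eight`: V2326 ⟺ **BoxVanishing 8** — every box-rational
  representation on `(0,1)⁸` of value `0` is a relation (⇒: the pair `(8, 0)` is allowed, compare with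
  the zero representation on the point, `boxVanishingDim_left_of_pair`; ⇐: pad both sides to the
  `8`-box and subtract there, `boxRigidityLe_of_boxVanishingDim`, both from `…Variants2238`);
* `stub_boxRigidity_var2326_iff_pair_eight_four`: already the single pair of dimensions `(8, 4)` is the
  whole variant (the bound `m' ≤ 4` may be frozen to `m' = 4`, or to `m' = 0`);
* `stub_boxRigidity_var2326_iff_le_eight`: V2326 ⟺ BoxRigidity with BOTH dimensions `≤ 8`;
* `stub_boxRigidity_var2326_iff_var2233`: V2326 coincides with the sibling V2233
  (`fix_nat:m=2; bound_nat:m'≤8`) — both are BoxVanishing 8, which decides every `ℚ`-linear relation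
  among the absolutely convergent `∫_{(0,1)^j} p/q`, `j ≤ 8` (all multiple zeta values of weight `≤ 8`,
  `ζ(3)`, `ζ(5)`, `ζ(7)`, `ζ(3)²` versus `ζ(6)`, `ζ(3)ζ(5)` versus `ζ(8)`, …) in favour of the four
  moves — nothing in the tree or in print proves that, and no invariant of `FormalRep` beyond `eval`
  exists to refute it;
* `boxVanishing_le_eight_of_stub_boxRigidity_var2326`: V2326 ⇒ BoxVanishing in every dimension `≤ 8`;
* `stub_boxRigidity_var2326_of_parent` / `_of_statement`: parent ⇒ V2326 and Summit ⇒ V2326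
  (`leaves_of_statement`), so a refutation of the variant would refute Conjecture 1 for the tree's
  calculus.
Source: M. Kontsevich, D. Zagier, *Periods* (2001), §1.2 Conjecture 1. Pure proof file, no definitions. -/

-- `Summit.<Summit>.<Problem>` is the tree's mandated summit-side namespace (CONVENTIONS §2); for this
-- single-conjunct summit the two coincide, so the duplicate is deliberate.
set_option linter.dupNamespace false

noncomputable section

namespace Summit.KontsevichZagierPeriods.KontsevichZagierPeriods.Theorems

open MeasureTheory Set
open Literature.NumberTheory.Transcendental Literature.NumberTheory.Transcendental.KZ
open Summit.KontsevichZagierPeriods.KontsevichZagierPeriods.Theses.HurwitzMicroSectors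
open Summit.KontsevichZagierPeriods.HurwitzMicroSectors.NormalFormPrinciple.PiBox

/-! ## The variant V2326: Conjecture 1 for box-rational periods of dimension `8` -/

/-- **V2326 ⟺ BoxVanishing in dimension `8`** (every box-rational representation on `(0,1)⁸` of value
`0` is a relation): (⇒) the pair of dimensions `(8, 0)` is allowed (`0 ≤ 4`), so compare a vanishing
box-rational representation on `(0,1)⁸` with the zero representation on the point
(`boxVanishingDim_left_of_pair`); (⇐) pad both representations to the `8`-box and subtract there
(`boxRigidityLe_of_boxVanishingDim 8` with `m = 8`, `m' ≤ 4 ≤ 8`). [cite: KontsevichZagier2001, §1.2 Conjecture 1] -/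
theorem stub_boxRigidity_var2326_iff_boxVanishing_eight :
    (∀ (m' : ℕ) (N : IntegralRep 8) (N' : IntegralRep m'), m' ≤ 4 → N.domain = {x | ∀ i, x i ∈ Set.Ioo (0:ℝ) 1} → N.IsRational → N'.domain = {x | ∀ i, x i ∈ Set.Ioo (0:ℝ) 1} → N'.IsRational → N.value = N'.value → Equivalent N N') ↔
    (∀ (M : IntegralRep 8), M.domain = {x | ∀ i, x i ∈ Set.Ioo (0:ℝ) 1} → M.IsRational →
      M.value = 0 → of M ∈ relations) :=
  ⟨fun h => boxVanishingDim_left_of_pair 8 0 fun N N' => h 0 N N' (Nat.zero_le 4),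
    fun hvan m' N N' hm' => boxRigidityLe_of_boxVanishingDim 8 hvan 8 m' N N' le_rfl (hm'.trans (by norm_num))⟩

/-- **V2326 ⟺ rigidity for the single pair of dimensions `(8, 4)`**: the bound `m' ≤ 4` may be frozen
to `m' = 4` without loss (both sides are BoxVanishing 8). [cite: KontsevichZagier2001, §1.2 Conjecture 1] -/
theorem stub_boxRigidity_var2326_iff_pair_eight_four :
    (∀ (m' : ℕ) (N : IntegralRep 8) (N' : IntegralRep m'), m' ≤ 4 → N.domain = {x | ∀ i, x i ∈ Set.Ioo (0:ℝ) 1} → N.IsRational → N'.domain = {x | ∀ i, x i ∈ Set.Ioo (0:ℝ) 1} → N'.IsRational → N.value = N'.value → Equivalent N N') ↔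
    (∀ (N : IntegralRep 8) (N' : IntegralRep 4), N.domain = {x | ∀ i, x i ∈ Set.Ioo (0:ℝ) 1} →
      N.IsRational → N'.domain = {x | ∀ i, x i ∈ Set.Ioo (0:ℝ) 1} → N'.IsRational →
      N.value = N'.value → Equivalent N N') := by
  rw [stub_boxRigidity_var2326_iff_boxVanishing_eight]
  exact ⟨fun hvan N N' => boxRigidityLe_of_boxVanishingDim 8 hvan 8 4 N N' le_rfl (by norm_num),
    fun h => boxVanishingDim_left_of_pair 8 4 h⟩

/-- **V2326 ⟺ BoxRigidity for all dimensions `m, m' ≤ 8`** (so V2326 coincides with every two-sided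
sibling of maximum dimension `8`). [cite: KontsevichZagier2001, §1.2 Conjecture 1] -/
theorem stub_boxRigidity_var2326_iff_le_eight :
    (∀ (m' : ℕ) (N : IntegralRep 8) (N' : IntegralRep m'), m' ≤ 4 → N.domain = {x | ∀ i, x i ∈ Set.Ioo (0:ℝ) 1} → N.IsRational → N'.domain = {x | ∀ i, x i ∈ Set.Ioo (0:ℝ) 1} → N'.IsRational → N.value = N'.value → Equivalent N N') ↔
    (∀ (m m' : ℕ) (N : IntegralRep m) (N' : IntegralRep m'), m ≤ 8 → m' ≤ 8 →
      N.domain = {x | ∀ i, x i ∈ Set.Ioo (0:ℝ) 1} → N.IsRational →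
      N'.domain = {x | ∀ i, x i ∈ Set.Ioo (0:ℝ) 1} → N'.IsRational →
      N.value = N'.value → Equivalent N N') := by
  rw [stub_boxRigidity_var2326_iff_boxVanishing_eight]
  exact ⟨fun hvan => boxRigidityLe_of_boxVanishingDim 8 hvan,
    fun h => boxVanishingDim_left_of_pair 8 8 fun N N' => h 8 8 N N' le_rfl le_rfl⟩

/-- **V2326 ⟺ V2233** (`fix_nat:m=2; bound_nat:m'≤8`): the two machine moves produce the same
statement, BoxVanishing 8. [cite: KontsevichZagier2001, §1.2 Conjecture 1] -/
theorem stub_boxRigidity_var2326_iff_var2233 :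
    (∀ (m' : ℕ) (N : IntegralRep 8) (N' : IntegralRep m'), m' ≤ 4 → N.domain = {x | ∀ i, x i ∈ Set.Ioo (0:ℝ) 1} → N.IsRational → N'.domain = {x | ∀ i, x i ∈ Set.Ioo (0:ℝ) 1} → N'.IsRational → N.value = N'.value → Equivalent N N') ↔
    (∀ (m' : ℕ) (N : IntegralRep 2) (N' : IntegralRep m'), m' ≤ 8 → N.domain = {x | ∀ i, x i ∈ Set.Ioo (0:ℝ) 1} → N.IsRational → N'.domain = {x | ∀ i, x i ∈ Set.Ioo (0:ℝ) 1} → N'.IsRational → N.value = N'.value → Equivalent N N') := by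
  rw [stub_boxRigidity_var2326_iff_boxVanishing_eight, stub_boxRigidity_var2233_iff_boxVanishing_eight]

/-- **V2326 ⇒ BoxVanishing in every dimension `j ≤ 8`** (monotonicity in the dimension, by padding):
in particular the dimension-`3` (`ζ(3)`), dimension-`5` (`ζ(5)`, `ζ(2)ζ(3)`) and dimension-`7`
(`ζ(7)`, `ζ(2)ζ(5)`, `ζ(3)ζ(4)`) statements. [cite: KontsevichZagier2001, §1.2 Conjecture 1] -/
theorem boxVanishing_le_eight_of_stub_boxRigidity_var2326
    (h : ∀ (m' : ℕ) (N : IntegralRep 8) (N' : IntegralRep m'), m' ≤ 4 → N.domain = {x | ∀ i, x i ∈ Set.Ioo (0:ℝ) 1} → N.IsRational → N'.domain = {x | ∀ i, x i ∈ Set.Ioo (0:ℝ) 1} → N'.IsRational → N.value = N'.value → Equivalent N N')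
    {j : ℕ} (hj : j ≤ 8) (N : IntegralRep j) (hNd : N.domain = {x | ∀ i, x i ∈ Set.Ioo (0:ℝ) 1})
    (hNr : N.IsRational) (hv : N.value = 0) : of N ∈ relations :=
  boxVanishingDim_mono hj (stub_boxRigidity_var2326_iff_boxVanishing_eight.1 h) N hNd hNr hv

/-- **The parent leaf ⇒ V2326** (the variant is a specialisation of `stub_boxRigidity`; the converse is
not claimed — the parent is BoxVanishing in ALL dimensions). [cite: KontsevichZagier2001, §1.2 Conjecture 1] -/
theorem stub_boxRigidity_var2326_of_parent
    (h : ∀ (m m' : ℕ) (N : IntegralRep m) (N' : IntegralRep m'), N.domain = {x | ∀ i, x i ∈ Set.Ioo (0:ℝ) 1} → N.IsRational → N'.domain = {x | ∀ i, x i ∈ Set.Ioo (0:ℝ) 1} → N'.IsRational → N.value = N'.value → Equivalent N N') :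
    ∀ (m' : ℕ) (N : IntegralRep 8) (N' : IntegralRep m'), m' ≤ 4 → N.domain = {x | ∀ i, x i ∈ Set.Ioo (0:ℝ) 1} → N.IsRational → N'.domain = {x | ∀ i, x i ∈ Set.Ioo (0:ℝ) 1} → N'.IsRational → N.value = N'.value → Equivalent N N' :=
  fun m' N N' _ => h 8 m' N N'

/-- **`KontsevichZagierPeriods ⇒ V2326`**: the variant is a special case of Conjecture 1 for the
tree's calculus (`leaves_of_statement`) — so a refutation of the variant would refute the Summit.
[cite: KontsevichZagier2001, §1.2 Conjecture 1] -/
theorem stub_boxRigidity_var2326_of_statement (h : _root_.KontsevichZagierPeriods) :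
    ∀ (m' : ℕ) (N : IntegralRep 8) (N' : IntegralRep m'), m' ≤ 4 → N.domain = {x | ∀ i, x i ∈ Set.Ioo (0:ℝ) 1} → N.IsRational → N'.domain = {x | ∀ i, x i ∈ Set.Ioo (0:ℝ) 1} → N'.IsRational → N.value = N'.value → Equivalent N N' :=
  stub_boxRigidity_var2326_of_parent (leaves_of_statement h).1

end Summit.KontsevichZagierPeriods.KontsevichZagierPeriods.Theorems

end
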